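import Summits.HodgeConjecture.CorCM.GaloisDodecicSimpleCMSixfolds
import Summits.HodgeConjecture.CorCM.OcticCMFieldAutomorphismsFibres
import Mathlib.GroupTheory.Perm.Cycle.Type
import HarnessLib

/-!
# Sharpness of the Galois-dodecic theorem: an ABELIAN Galois CM field of degree `12` with an imaginary quadratic
# subfield carries a primitive DEGENERATE CM type — and the resulting classification

COR-CM (cell `pub-hodgecm2`), binder seat b04 (gen 14), count-neutral claim GALOIS-DODECIC, part III; sequel of
`CorCM/GaloisDodecicSimpleCMSixfolds` (part II: for a Galois CM field `K` of degree `12`, a primitive degenerate CM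
type forces an imaginary quadratic subfield `k` with `Gal(K/k)` abelian).  KERNEL ONLY: theorems, no definition, no
named fact, no `sorry`.  `HC_CM` is not used and not claimed.

§1 `exists_orderOf_eq_six` — a commutative subgroup of order `6` contains an element of order `6` (Cauchy for `2`
   and `3`, coprime orders).
§2 The model type.  In `M = ℤ/2 × ℤ/6` with "conjugation" `c₀ = (1,0)` the set
   `T₀ = {(0,0), (0,3), (0,5), (1,1), (1,2), (1,4)}` is a CM set (`x ∈ T₀ ↔ x + c₀ ∉ T₀`), has trivial stabiliser
   (for every `v ≠ 0` some `w` has `w ∈ T₀ ↮ v + w ∈ T₀`), and meets each coset of `{0} × ℤ/6` in exactly three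
   points — all decided by the kernel (`GaloisDodecic.Sharp.model_*`).
§3 `exists_isPrimitive_not_isNondegenerate_of_comm` — **for a GALOIS CM field `K` of degree `12` with COMMUTATIVE
   Galois group and an imaginary quadratic subfield `k`, some PRIMITIVE CM type of `K` is DEGENERATE**: with `c`
   complex conjugation and `g` a generator of the cyclic group `Gal(K/k)` (order `6`), the map
   `ψ(b, m) = c^b g^m` is a bijection `ℤ/2 × ℤ/6 → Gal(K/ℚ)` turning addition into multiplication, and
   `Φ = {σ_{ψ(x)} | x ∈ T₀}` (`σ_h = φ₀ ∘ h⁻¹`) is a CM type, primitive (the translates `τΦ`, `τ ∈ Aut(ℂ)`, act through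
   `x ↦ x − d` on the model), and balanced `(3,3)` over `k`, hence degenerate by
   `CMSixfoldRank.not_isNondegenerate_iff_exists_weilFibre`.
§4 The classification for Galois CM fields of degree `12` (`forall_isNondegenerate_iff`): **every primitive CM type
   of `K` is nondegenerate — equivalently, every simple abelian sixfold with CM by `K` has `Hdg(Aⁿ) = Div(Aⁿ)` for all
   `n` — if and only if `Gal(K/ℚ)` is non-abelian or `K` has no imaginary quadratic subfield**; for abelian
   `Gal(K/ℚ)` the criterion is exactly "no imaginary quadratic subfield" (`forall_isNondegenerate_iff_of_comm`).  The
   excluded fields are those with `Gal(K/ℚ) ≅ ℤ/2 × ℤ/6` (e.g. `ℚ(ζ₂₁), ℚ(ζ₂₈), ℚ(ζ₃₆)`).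
Print context: [Dodson1984] §4 (p. 18), §5.3 ("preliminary results for `n = 6`"; degenerate examples for
`G₀ = ℤ₆`); [MoonenZarhin1999LowDim] Thm. 0.1 (1.4).  The classification as stated is NEW.
-/

noncomputable section

open CategoryTheory CategoryTheory.Limits NumberField

namespace Summit.HodgeConjecture.CorCM.GaloisDodecic

open Literature.NumberTheory.ComplexMultiplication
open Literature.AlgebraicGeometry.Motives (AbelianVariety CMType)
open Literature.AlgebraicGeometry.Pohlmann1968
open Literature.AlgebraicGeometry.HodgeTheory
open Literature.AlgebraicGeometry.ComplexMultiplication (IsCMTypeRealisation isSimple_iff_isPrimitive)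
open Literature.Barriers.HodgeConjecture (divisorClassesSpan)
open Summit.HodgeConjecture.CorCM.GaloisOctic

open scoped Classical

/-! ## §1 A commutative subgroup of order `6` has an element of order `6` -/

section Group

variable {G : Type*} [Group G]

/-- A commutative subgroup of order `6` contains an element of order `6` (an element of order `2` times one of
order `3`, Cauchy; coprime orders multiply for commuting elements). [folklore] -/
theorem exists_orderOf_eq_six {H : Subgroup G} (hH : Nat.card H = 6) (hcomm : ∀ a ∈ H, ∀ b ∈ H, a * b = b * a) :
    ∃ g ∈ H, orderOf g = 6 := by
  haveI : Finite H := Nat.finite_of_card_ne_zero (by rw [hH]; norm_num)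
  obtain ⟨a, ha⟩ := exists_prime_orderOf_dvd_card' (G := H) 2 (by rw [hH]; norm_num)
  obtain ⟨b, hb⟩ := exists_prime_orderOf_dvd_card' (G := H) 3 (by rw [hH]; norm_num)
  have hab : Commute a b := Subtype.ext (hcomm _ a.2 _ b.2)
  have h6 : orderOf (a * b) = 6 := by
    rw [hab.orderOf_mul_eq_mul_orderOf_of_coprime (by rw [ha, hb]; decide), ha, hb]
  exact ⟨((a * b : H) : G), (a * b).2, by rw [Subgroup.orderOf_coe, h6]⟩

end Group

/-! ## §2 The model type in `ℤ/2 × ℤ/6` (kernel-decided) -/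

namespace Sharp

/-- `T₀` is a CM set for `c₀ = (1,0)`: `x ∈ T₀ ↔ x + c₀ ∉ T₀`. [folklore] -/
theorem model_cm : ∀ x : ZMod 2 × ZMod 6,
    x ∈ ({(0,0), (0,3), (0,5), (1,1), (1,2), (1,4)} : Finset (ZMod 2 × ZMod 6)) ↔
      (1, 0) + x ∉ ({(0,0), (0,3), (0,5), (1,1), (1,2), (1,4)} : Finset (ZMod 2 × ZMod 6)) := by
  decide

/-- `T₀` has trivial stabiliser: every `v ≠ 0` moves some point across the boundary of `T₀`. [folklore] -/
theorem model_primitive : ∀ v : ZMod 2 × ZMod 6, v ≠ 0 → ∃ w : ZMod 2 × ZMod 6,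
    ¬ (w ∈ ({(0,0), (0,3), (0,5), (1,1), (1,2), (1,4)} : Finset (ZMod 2 × ZMod 6)) ↔
      v + w ∈ ({(0,0), (0,3), (0,5), (1,1), (1,2), (1,4)} : Finset (ZMod 2 × ZMod 6))) := by
  decide

/-- `T₀` meets each coset of `{0} × ℤ/6` in three points, and so does its complement. [folklore] -/
theorem model_balanced (b : ZMod 2) :
    (Finset.univ.filter fun x : ZMod 2 × ZMod 6 =>
        x.1 = b ∧ x ∈ ({(0,0), (0,3), (0,5), (1,1), (1,2), (1,4)} : Finset (ZMod 2 × ZMod 6))).card = 3 ∧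
    (Finset.univ.filter fun x : ZMod 2 × ZMod 6 =>
        x.1 = b ∧ x ∉ ({(0,0), (0,3), (0,5), (1,1), (1,2), (1,4)} : Finset (ZMod 2 × ZMod 6))).card = 3 := by
  revert b
  decide

end Sharp

/-! ## §3 Abelian Galois group and an imaginary quadratic subfield ⟹ a primitive degenerate type -/

section Main

variable {K : Type} [Field K] [NumberField K] [IsCMField K]

/-- **Sharpness.**  Let `K` be a GALOIS CM field of degree `12` whose Galois group is COMMUTATIVE and which contains
a quadratic subfield `k` with a complex place (an imaginary quadratic subfield).  Then `K` has a PRIMITIVE CM type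
which is DEGENERATE (Kubota rank `6`): `Φ = {σ_{c^b g^m} | (b, m) ∈ T₀}` for a generator `g` of the cyclic group
`Gal(K/k)` and the model set `T₀ ⊆ ℤ/2 × ℤ/6` of §2 — a CM type, primitive because `T₀` has trivial stabiliser,
and balanced `(3,3)` over `k`.  So the hypothesis "non-abelian or cyclic" of part II cannot be weakened to
"Galois".  NEW (degenerate examples for `G₀ = ℤ₆` in print: [cite: Dodson1984, §5.3 (pp. 26–27)];
cf. [cite: MoonenZarhin1999LowDim, Thm. 0.1 (1.4)]). -/
theorem exists_isPrimitive_not_isNondegenerate_of_comm [IsGalois ℚ K] (hK : Module.finrank ℚ K = 12)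
    (hcomm : ∀ x y : K ≃ₐ[ℚ] K, x * y = y * x) (k : IntermediateField ℚ K) (hk2 : Module.finrank ℚ k = 2)
    (τ₀ : k →+* ℂ) (hτ₀ : ComplexEmbedding.conjugate τ₀ ≠ τ₀) (φ₀ : K →+* ℂ) :
    ∃ Φ : CMType K, IsPrimitive (ℂ ≃+* ℂ) Φ.1 φ₀ ∧ ¬ IsNondegenerate Φ := by
  haveI := isPretransitive_ringEquiv_complex (K := K)
  set G := K ≃ₐ[ℚ] K
  set c : G := (IsCMField.complexConj K).restrictScalars ℚ with hc_def
  set H : Subgroup G := k.fixingSubgroup with hH_def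
  set T₀ : Finset (ZMod 2 × ZMod 6) := {(0,0), (0,3), (0,5), (1,1), (1,2), (1,4)} with hT₀_def
  -- `|G| = 12`, `|H| = 6`, `c ∉ H`, `c` of order `2`
  have hG : Nat.card G = 12 := by rw [IsGalois.card_aut_eq_finrank, hK]
  have hKk : Module.finrank k K = 6 := by
    have h := Module.finrank_mul_finrank ℚ k K
    rw [hK, hk2] at h
    omega
  have hH : Nat.card H = 6 := by rw [hH_def, IsGalois.card_fixingSubgroup_eq_finrank k, hKk]
  have hcH : c ∉ H := complexConj_not_mem_fixingSubgroup k τ₀ hτ₀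
  have hc1 : c ≠ 1 := fun h => hcH (h ▸ H.one_mem)
  have hcc : c * c = 1 := complexConj_mul_self
  have hoc : orderOf c = 2 := orderOf_eq_prime (by rw [pow_two, hcc]) hc1
  have hv1 : (1 : ZMod 2).val = 1 := rfl
  have h2' : ∀ a : ZMod 2, a ≠ 0 → a = 1 := by decide
  -- a generator `g` of `H`
  obtain ⟨g, hgH, hog⟩ := exists_orderOf_eq_six hH fun a _ b _ => hcomm a b
  -- the parametrisation `ψ (b, m) = c^b g^m`
  set ψ : ZMod 2 × ZMod 6 → G := fun x => c ^ x.1.val * g ^ x.2.val with hψ_def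
  have hc2 : ∀ n : ℕ, c ^ (n % 2) = c ^ n := fun n => by rw [← hoc]; exact pow_mod_orderOf c n
  have hg6 : ∀ n : ℕ, g ^ (n % 6) = g ^ n := fun n => by rw [← hog]; exact pow_mod_orderOf g n
  have hψmul : ∀ x y, ψ (x + y) = ψ x * ψ y := by
    intro x y
    simp only [hψ_def, Prod.fst_add, Prod.snd_add, ZMod.val_add]
    rw [hc2, hg6, pow_add, pow_add, mul_assoc, mul_assoc, ← mul_assoc (c ^ y.1.val),
      hcomm (c ^ y.1.val) (g ^ x.2.val)]
    simp only [mul_assoc]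
  have hψH : ∀ x, ψ x ∈ H ↔ x.1 = 0 := by
    intro x
    constructor
    · intro hx
      by_contra h1
      have hx1 : x.1 = 1 := h2' x.1 h1
      apply hcH
      have : ψ x = c * g ^ x.2.val := by
        show c ^ x.1.val * g ^ x.2.val = _
        rw [hx1, hv1, pow_one]
      rw [this] at hx
      exact (Subgroup.mul_mem_cancel_right H (H.pow_mem hgH _)).1 hx
    · intro h0
      simp only [hψ_def, h0, ZMod.val_zero, pow_zero, one_mul]
      exact H.pow_mem hgH _
  have hψinj : Function.Injective ψ := by
    -- kernel is trivial
    have hz : ∀ z, ψ z = 1 → z = 0 := by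
      intro z hz
      have hz1 : z.1 = 0 := (hψH z).1 (hz ▸ H.one_mem)
      have hz2 : z.2 = 0 := by
        have hpow : g ^ z.2.val = 1 := by
          have : ψ z = g ^ z.2.val := by simp only [hψ_def, hz1, ZMod.val_zero, pow_zero, one_mul]
          rw [← this, hz]
        by_contra hne
        have hpos : 0 < z.2.val := Nat.pos_of_ne_zero fun h0 => hne ((ZMod.val_eq_zero z.2).1 h0)
        have hle := orderOf_le_of_pow_eq_one hpos hpow
        have hlt := z.2.val_lt
        rw [hog] at hle
        omega
      exact Prod.ext hz1 hz2
    intro x y hxy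
    have h := hψmul (x - y) y
    rw [sub_add_cancel, hxy] at h
    have h1 : (1 : G) * ψ y = ψ (x - y) * ψ y := by rw [one_mul]; exact h
    have := hz _ (mul_right_cancel h1).symm
    rwa [sub_eq_zero] at this
  have hψbij : Function.Bijective ψ :=
    hψinj.bijective_of_nat_card_le (by rw [hG, Nat.card_prod, Nat.card_zmod, Nat.card_zmod])
  have hψc : ψ (1, 0) = c := by
    show c ^ (1 : ZMod 2).val * g ^ (0 : ZMod 6).val = c
    rw [ZMod.val_zero, pow_zero, mul_one, hv1, pow_one]
  -- the embeddings `E x = σ_{ψ x}`; every embedding is some `E x`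
  set E : ZMod 2 × ZMod 6 → (K →+* ℂ) := fun x => embOf φ₀ (ψ x) with hE_def
  have hEinj : Function.Injective E := fun x y hxy => hψinj ((embOf_bijective φ₀).1 hxy)
  have hEsurj : ∀ φ : K →+* ℂ, ∃ x, E x = φ := fun φ => by
    obtain ⟨h, rfl⟩ := (embOf_bijective φ₀).2 φ
    obtain ⟨x, rfl⟩ := hψbij.2 h
    exact ⟨x, rfl⟩
  have hEconj : ∀ x, ComplexEmbedding.conjugate (E x) = E ((1, 0) + x) := fun x => by
    show ComplexEmbedding.conjugate (embOf φ₀ (ψ x)) = embOf φ₀ (ψ ((1, 0) + x))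
    rw [hψmul, hψc, embOf_complexConj_mul]
  have hEsmul : ∀ (x d : ZMod 2 × ZMod 6) {τ : ℂ ≃+* ℂ}, (∀ a, τ (φ₀ a) = φ₀ (ψ d a)) →
      τ • E x = E (x - d) := by
    intro x d τ hτ
    show τ • embOf φ₀ (ψ x) = embOf φ₀ (ψ (x - d))
    rw [smul_embOf_of_comp φ₀ hτ]
    congr 1
    rw [mul_inv_eq_iff_eq_mul, ← hψmul, sub_add_cancel]
  -- the CM type `Φ = E(T₀)`
  set S : Set (K →+* ℂ) := E '' (T₀ : Set (ZMod 2 × ZMod 6)) with hS_def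
  have hmemE : ∀ x, E x ∈ S ↔ x ∈ T₀ := fun x => by
    rw [hS_def, hEinj.mem_set_image, Finset.mem_coe]
  have hcm : ∀ φ, φ ∈ S ↔ ComplexEmbedding.conjugate φ ∉ S := by
    intro φ
    obtain ⟨x, rfl⟩ := hEsurj φ
    rw [hEconj, hmemE, hmemE]
    exact Sharp.model_cm x
  let Φ : CMType K := ⟨S, hcm⟩
  -- primitive: the translates act through `x ↦ x - d`, and `T₀` has trivial stabiliser
  have hprim : IsPrimitive (ℂ ≃+* ℂ) Φ.1 φ₀ := by
    rw [isPrimitive_iff_forall_eq]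
    intro φ₁ φ₂ hsep
    obtain ⟨x₁, rfl⟩ := hEsurj φ₁
    obtain ⟨x₂, rfl⟩ := hEsurj φ₂
    by_contra hne
    have hv : x₂ - x₁ ≠ 0 := fun h => hne (by rw [sub_eq_zero] at h; rw [h])
    obtain ⟨w, hw⟩ := Sharp.model_primitive (x₂ - x₁) hv
    obtain ⟨τ, hτ⟩ := exists_ringEquiv_comp_eq_algEquiv φ₀ (ψ (x₁ - w))
    have h := hsep τ
    rw [hEsmul x₁ (x₁ - w) hτ, hEsmul x₂ (x₁ - w) hτ, sub_sub_cancel,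
      show x₂ - (x₁ - w) = x₂ - x₁ + w by abel] at h
    exact hw ((hmemE w).symm.trans (h.trans (hmemE _)))
  refine ⟨Φ, hprim, ?_⟩
  -- degenerate: balanced `(3,3)` over `k`
  rw [CMSixfoldRank.not_isNondegenerate_iff_exists_weilFibre hK φ₀ hprim]
  refine ⟨k, hk2, τ₀, hτ₀, fun τ => ?_⟩
  -- restriction of `E x` to `k`
  have hres0 : ∀ x, (E x).comp (algebraMap k K) = φ₀.comp (algebraMap k K) ↔ x.1 = 0 := fun x => by
    show (embOf φ₀ (ψ x)).comp (algebraMap k K) = _ ↔ _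
    rw [embOf_comp_algebraMap_eq_iff, hψH]
  have hconj_comp : ∀ φ : K →+* ℂ, (ComplexEmbedding.conjugate φ).comp (algebraMap k K) =
      ComplexEmbedding.conjugate (φ.comp (algebraMap k K)) := fun φ => rfl
  have hcc' : ∀ ρ : k →+* ℂ, ComplexEmbedding.conjugate (ComplexEmbedding.conjugate ρ) = ρ :=
    fun ρ => star_star ρ
  have h2 : ∀ a : ZMod 2, a = 0 ∨ a = 1 := by decide
  have hres1 : ∀ x, (E x).comp (algebraMap k K) = ComplexEmbedding.conjugate (φ₀.comp (algebraMap k K)) ↔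
      x.1 = 1 := fun x => by
    constructor
    · intro h
      have h' : (E ((1, 0) + x)).comp (algebraMap k K) = φ₀.comp (algebraMap k K) := by
        rw [← hEconj, hconj_comp, h, hcc']
      have h0 := (hres0 _).1 h'
      simp only [Prod.fst_add] at h0
      rcases h2 x.1 with hx | hx
      · rw [hx] at h0; exact absurd h0 (by decide)
      · exact hx
    · intro hx
      have h' : (E ((1, 0) + x)).comp (algebraMap k K) = φ₀.comp (algebraMap k K) := by
        rw [hres0]
        simp only [Prod.fst_add, hx]
        decide
      rw [← hEconj, hconj_comp] at h'
      rw [← hcc' ((E x).comp (algebraMap k K)), h']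
  -- fibres over `k` as images of model sets
  have hfib : ∀ (ρ : k →+* ℂ) (P : (K →+* ℂ) → Prop),
      {φ : K →+* ℂ | φ.comp (algebraMap k K) = ρ ∧ P φ} =
        E '' {x | (E x).comp (algebraMap k K) = ρ ∧ P (E x)} := by
    intro ρ P
    ext φ
    constructor
    · rintro ⟨hφ, hP⟩
      obtain ⟨x, rfl⟩ := hEsurj φ
      exact ⟨x, ⟨hφ, hP⟩, rfl⟩
    · rintro ⟨x, ⟨hx, hP⟩, rfl⟩
      exact ⟨hx, hP⟩
  have hcount : ∀ b : ZMod 2,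
      {x : ZMod 2 × ZMod 6 | x.1 = b ∧ E x ∈ S}.ncard = 3 ∧ {x : ZMod 2 × ZMod 6 | x.1 = b ∧ E x ∉ S}.ncard = 3 := by
    intro b
    obtain ⟨hin, hout⟩ := Sharp.model_balanced b
    rw [← hT₀_def] at hin hout
    constructor
    · rw [← hin, ← Set.ncard_coe_finset]
      congr 1
      ext x
      simp only [Set.mem_setOf_eq, Finset.coe_filter, Finset.mem_univ, true_and, hmemE]
    · rw [← hout, ← Set.ncard_coe_finset]
      congr 1
      ext x
      simp only [Set.mem_setOf_eq, Finset.coe_filter, Finset.mem_univ, true_and, hmemE]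
  -- `φ₀|_k` is not real, and `τ` is `φ₀|_k` or its conjugate
  have hφ₀k : ComplexEmbedding.conjugate (φ₀.comp (algebraMap k K)) ≠ φ₀.comp (algebraMap k K) :=
    conjugate_ne_of_finrank_eq_two k hk2 τ₀ hτ₀ φ₀
  obtain ⟨g', hg'⟩ := exists_embOf_comp_algebraMap_eq φ₀ k τ
  rcases comp_algebraMap_eq_or k hk2 (φ₀.comp (algebraMap k K)) hφ₀k (embOf φ₀ g') with hτ | hτ
  · -- `τ = φ₀|_k`: the fibre is `E({0} × ℤ/6)`
    rw [← hg', hτ, hfib _ (fun φ => φ ∈ Φ.1), hfib _ (fun φ => φ ∉ Φ.1), Set.ncard_image_of_injective _ hEinj,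
      Set.ncard_image_of_injective _ hEinj]
    simp only [hres0]
    rw [(hcount 0).1, (hcount 0).2]
  · -- `τ = conj(φ₀|_k)`: the fibre is `E({1} × ℤ/6)`
    rw [← hg', hτ, hfib _ (fun φ => φ ∈ Φ.1), hfib _ (fun φ => φ ∉ Φ.1), Set.ncard_image_of_injective _ hEinj,
      Set.ncard_image_of_injective _ hEinj]
    simp only [hres1]
    rw [(hcount 1).1, (hcount 1).2]

/-! ## §4 The classification for Galois CM fields of degree `12` -/

variable {Φ : CMType K}

/-- **Abelian Galois group: nondegeneracy of all primitive types ⟺ no imaginary quadratic subfield.**  For a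
GALOIS CM field of degree `12` with commutative Galois group, every primitive CM type is nondegenerate iff every
quadratic subfield of `K` is real (`⟸`: part II, `isNondegenerate_of_isPrimitive_of_forall_quadratic_isReal`;
`⟹`: §3). [cite: Dodson1984, §5.3 (pp. 26–27)] [cite: MoonenZarhin1999LowDim, Thm. 0.1 (1.4)] -/
theorem forall_isNondegenerate_iff_of_comm [IsGalois ℚ K] (hK : Module.finrank ℚ K = 12)
    (hcomm : ∀ x y : K ≃ₐ[ℚ] K, x * y = y * x) (φ₀ : K →+* ℂ) :
    (∀ Φ : CMType K, IsPrimitive (ℂ ≃+* ℂ) Φ.1 φ₀ → IsNondegenerate Φ) ↔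
      ∀ k : IntermediateField ℚ K, Module.finrank ℚ k = 2 → ∀ τ : k →+* ℂ, ComplexEmbedding.conjugate τ = τ := by
  constructor
  · intro h k hk2 τ
    by_contra hτ
    obtain ⟨Φ, hprim, hdeg⟩ := exists_isPrimitive_not_isNondegenerate_of_comm hK hcomm k hk2 τ hτ φ₀
    exact hdeg (h Φ hprim)
  · intro hreal Φ hprim
    exact isNondegenerate_of_isPrimitive_of_forall_quadratic_isReal hK hreal φ₀ hprim

/-- **The classification (Galois CM fields of degree `12`).**  Every primitive CM type of `K` is nondegenerate —
equivalently, every simple abelian sixfold with CM by `K` has `Hdg(Aⁿ) = Div(Aⁿ)` for all `n` — if and only if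
`Gal(K/ℚ)` is NON-ABELIAN or `K` has NO imaginary quadratic subfield.  The excluded fields are exactly those with
`Gal(K/ℚ)` abelian containing an imaginary quadratic subfield (`Gal(K/ℚ) ≅ ℤ/2 × ℤ/6`; e.g. `ℚ(ζ₂₁), ℚ(ζ₂₈), ℚ(ζ₃₆)`).
NEW. [cite: Dodson1984, §4 (p. 18) and §5.3] [cite: MoonenZarhin1999LowDim, Thm. 0.1 (1.4)] -/
theorem forall_isNondegenerate_iff [IsGalois ℚ K] (hK : Module.finrank ℚ K = 12) (φ₀ : K →+* ℂ) :
    (∀ Φ : CMType K, IsPrimitive (ℂ ≃+* ℂ) Φ.1 φ₀ → IsNondegenerate Φ) ↔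
      ((∃ x y : K ≃ₐ[ℚ] K, x * y ≠ y * x) ∨
        ∀ k : IntermediateField ℚ K, Module.finrank ℚ k = 2 → ∀ τ : k →+* ℂ, ComplexEmbedding.conjugate τ = τ) := by
  constructor
  · intro h
    by_cases hG : ∃ x y : K ≃ₐ[ℚ] K, x * y ≠ y * x
    · exact Or.inl hG
    · push Not at hG
      exact Or.inr ((forall_isNondegenerate_iff_of_comm hK hG φ₀).1 h)
  · rintro (hG | hreal) Φ hprim
    · exact isNondegenerate_of_isPrimitive_of_isGalois_twelve_of_not_comm hK hG φ₀ hprim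
    · exact isNondegenerate_of_isPrimitive_of_forall_quadratic_isReal hK hreal φ₀ hprim

/-- **Primitive CM types of CM fields of degree `≤ 14` are nondegenerate, given Galois-ness in degree `8` and, in
degree `12`, Galois-ness with non-abelian or cyclic group** — so among simple CM abelian varieties of dimension `≤ 7`
with GALOIS CM field, the degenerate ones are exactly some sixfolds whose field has group `ℤ/2 × ℤ/6` (§3): degrees
`≤ 12` by part II's umbrella, degree `14 = 2·7` by the prime theorem (Ribet–Tankeev–Yanai, tree
`isNondegenerate_of_isPrimitive_of_prime`); a CM field has even degree. [cite: Dodson1984, §4 (p. 18) and §5.3]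
[cite: Ribet1980, Examples (3.7) (pp. 87–88)] -/
theorem isNondegenerate_of_isPrimitive_of_finrank_le_fourteen (hK : Module.finrank ℚ K ≤ 14)
    (hGal8 : Module.finrank ℚ K = 8 → IsGalois ℚ K)
    (hGal12 : Module.finrank ℚ K = 12 →
      IsGalois ℚ K ∧ ((∃ x y : K ≃ₐ[ℚ] K, x * y ≠ y * x) ∨ IsCyclic (K ≃ₐ[ℚ] K)))
    (φ₀ : K →+* ℂ) (hprim : IsPrimitive (ℂ ≃+* ℂ) Φ.1 φ₀) : IsNondegenerate Φ := by
  have heven : Module.finrank ℚ K = Module.finrank ℚ (maximalRealSubfield K) * 2 := by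
    rw [← Algebra.IsQuadraticExtension.finrank_eq_two (maximalRealSubfield K) K, Module.finrank_mul_finrank]
  by_cases h12 : Module.finrank ℚ K ≤ 12
  · exact isNondegenerate_of_isPrimitive_of_finrank_le_twelve h12 hGal8 hGal12 φ₀ hprim
  · have h14 : Module.finrank ℚ K = 2 * 7 := by omega
    exact isNondegenerate_of_isPrimitive_of_prime (Φ := Φ) (by norm_num) h14 φ₀ hprim

/-- On the variety: **a Galois CM field of degree `12` with abelian Galois group and an imaginary quadratic subfield
is the CM field of DEGENERATE simple CM abelian sixfolds** — every realisation `(A, ι, θ)` of the type of §3 is SIMPLE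
and carries, on some power `Aⁿ`, a rational `(m,m)`-class which is not a polynomial in divisor classes (Hazama's
criterion, tree `exists_exceptional_pow_of_not_isNondegenerate`).  (The existence of a realisation is Riemann's
theorem, not re-derived here.) [cite: Gordon1999HodgeAVSurvey, Thm. 6.4 and 9.4] -/
theorem exists_cmType_forall_realisation_exceptional [IsGalois ℚ K] (hK : Module.finrank ℚ K = 12)
    (hcomm : ∀ x y : K ≃ₐ[ℚ] K, x * y = y * x) (k : IntermediateField ℚ K) (hk2 : Module.finrank ℚ k = 2)
    (τ₀ : k →+* ℂ) (hτ₀ : ComplexEmbedding.conjugate τ₀ ≠ τ₀) (φ₀ : K →+* ℂ) :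
    ∃ Φ : CMType K, IsPrimitive (ℂ ≃+* ℂ) Φ.1 φ₀ ∧ ¬ IsNondegenerate Φ ∧
      ∀ (A : AbelianVariety ℂ) (ι : 𝓞 K →+* End A) (θ : K →+* Module.End ℂ (complexBetti A.X 1)),
        IsCMTypeRealisation Φ A ι θ → A.IsSimple ∧
          ∃ n m : ℕ, ∃ x : complexBetti (⨁ fun _ : Fin n => A).X (2 * m), IsRationalClass x ∧
            IsOfHodgeType (⨁ fun _ : Fin n => A).dim (⨁ fun _ : Fin n => A).X (2 * m) m m x ∧
            x ∉ divisorClassesSpan (⨁ fun _ : Fin n => A).X (⨁ fun _ : Fin n => A).dim m := by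
  obtain ⟨Φ, hprim, hdeg⟩ := exists_isPrimitive_not_isNondegenerate_of_comm hK hcomm k hk2 τ₀ hτ₀ φ₀
  exact ⟨Φ, hprim, hdeg, fun A ι θ hA =>
    ⟨(isSimple_iff_isPrimitive hA φ₀).2 hprim, exists_exceptional_pow_of_not_isNondegenerate φ₀ hprim hdeg hA⟩⟩

end Main

end Summit.HodgeConjecture.CorCM.GaloisDodecic

end
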